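/-
Copyright (c) 2026 the pub-hodgecm-mathlib formalisation cell (harness21).  Prover seat hodgecm-mathlib-K2E1-p13 (g5), Track B ∕ K2-LIT, h413 = `stmt-HodgeConjecture-24833`,
R90-TF section S8 «ContSpec-n½» (dealer R90-CS-plan (g3), deal S8-R166 (3)): `hSCAT` — the continued scalars and the pole data of ★ `K2E1ChiResidueNormSqOfTubeCMThree.msBound_middlePole_of_tube_letters`
((L2) + (L3)) COMPOSED from ★ K2E1-p16's scattering-coordinate chain (p863497 → p863516 → p863532 (L2) → p863573 (L3)), for the consumer K2E1-p12's ℓ-ROAD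
`R90S8ResGMidBlockMSRoadOfLettersU3` at the mid block of record.
-/
import Summits.HodgeConjecture.HodgeConjecture.Theorems.K2E1ChiResidueNormSqOfTubeCMThree               -- ★ p863403 (K2E1-p16): the (L1)(L2)(L3) consumer `msBound_middlePole_of_tube_letters` (currency of the clauses)
import Summits.HodgeConjecture.HodgeConjecture.Theorems.K2E1ChiScatteringPairingsContinuedCMThree       -- ★ p863516 (L2) part 2a: `differentiableOn_wc`, `wc_agree`, `differentiableOn_Bc_fst`, `differentiableOn_Bc_snd_conj`, `Bc_agree`, `wc_eq_mul_bracket`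
import Summits.HodgeConjecture.HodgeConjecture.Theorems.K2E1ChiPoleDataAtThreeHalvesOfScalarRoadCMThree  -- ★ p863573 (L3) of letters: `exists_analytic_mul_wc_of_coords`, `exists_bound_normSq_mul_kernel_of_coords`, `coords_poleData_of_factorisation`
import Summits.HodgeConjecture.HodgeConjecture.Theorems.R90S8ResGMidBlockMSRoadOfLettersU3                 -- ★ p863731 (K2E1-p12): the ℓ-ROAD head whose binder `hSCAT` §5 (ED. 2) pays from the scattering letters (vocabulary of the frame; brings ★ `exists_bound_of_mem_chiSectionSpacePair_midBlock`)
import HarnessLib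

/-!
# K2·E1 ∕ R90·S8 — `R90S8ResGMidBlockScatteringOfRecordU3`: THE `hSCAT` LETTER OF THE ℓ-ROAD — `∃ wc Bc d` WITH THE (L2) HOLOMORPHY ∕ TUBE-AGREEMENT CLAUSES AND THE (L3) POLE DATA OF
# ★ p863403, COMPOSED FROM THE ★ MEROMORPHIC-EXPORTS TUPLE `(q, qc, P)` ON A SCATTERING BASIS AND PER-COORDINATE SIMPLE-POLE DATA AT `3∕2` (EULER ROUTE ∕ NON-SELF-ASSOCIATE CASE)

Cell `pub/hodgecm-mathlib`, crux h413 = `stmt-HodgeConjecture-24833`, route of record `HCCMUnconditional`; R90-TF section S8 «ContSpec-n½», socket (R)′ (★ p863422) and its ℓ-ROAD OF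
LETTERS (K2E1-p12 (g5), census `R90/S8/CENSUS-lROAD.K2E1-p12-g5.md`: head `res_midBlock_le_residual_of_letters` triple-primed with letters `hDISC hCONT hSCAT hSCAL`).  THEOREMS ONLY
(no `def`, no `instance`, no notation, no named-fact hypothesis, no `sorry`; default heartbeats); lane `--supports stmt-HodgeConjecture-24833 --as helper` (count-neutral).  Closes no socket.

THE MATHEMATICS ([MoeglinWaldspurger1995] IV.1.9–IV.1.11, IV.2.3, IV.3.12 (a); [BernsteinLapid2019] Thm 2.3, §4; [Rogawski1990] §13.9).  ★ p863403 `msBound_middlePole_of_tube_letters` asks for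
CONTINUED SCALARS `wc`, `Bc` — (L2): holomorphic (resp. separately holomorphic ∕ anti-holomorphic) on the quarter-plane domains `D₁ ⊆ D⁺`, `D₂ ⊆ D⁻` and AGREEING on the tube `{2 < Re}` with
the literal intertwining pairings `w s = ∫_{‖x‖≤1 ∩ 𝓕_I} ‖x‖·(χ₁ʷ conj χ₁)(x)·⟨φ̃_s, φ⟩_K`, `B s s′ = κ·⟨φ̃_s, φ̃_{s′}⟩_K` — and POLE DATA (L3) at `3∕2`: `d` analytic with `d = (z − 3∕2)·wc`,
`|z − 3∕2|²·‖Bc z z‖` bounded (and `wc` real on the axis — the letter `hreal`).  GIVEN a SCATTERING BASIS `φ′_j` with TUBE COORDINATES `Σ_j q_j(z)•φ′_j = (ν𝓕)⁻¹•φ̃_z` on `{2 < Re}`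
(the `hqφ` letter of the ★ meromorphic exports, `ν 𝓕 = 1`) and CONTINUED COORDINATES `qc_j` holomorphic off the pole set `P` with `qc_j = q_j` on the tube (the ★ exports tuple
`chiEisenstein_meromorphic_exports_*_cm_three*`: `DifferentiableOn ℂ (qc_j) Pᶜ`, agreement on `{2 < Re}`), open domains `D₁, D₂ ⊆ Pᶜ` (χ POLE LEDGER: the poles in `{1 < Re}` are
real), integrable Gram pairings on `K`, and PER-COORDINATE SIMPLE-POLE DATA `d_j` analytic at `3∕2` with `d_j = (z − 3∕2)·qc_j` nearby, the DEFINITION-FREE candidates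
`wc s := ∫ ‖x‖·(η(x)·Σ_j qc_j(s)·G_j)`, `G_j = ⟨φ′_j, φ⟩_K`, `Bc s s′ := κ·Σ_{j,l} qc_j(s) conj qc_l(s′) G_{jl}`, `d := (Σ_j d_j G_j)·[η]` satisfy ALL of (L2) and `hd hdw hβB` of (L3):
* §1 **`exists_hSCAT_of_coords`** — the composition (★ p863516 §1–§4 for (L2) over ★ p863497; ★ p863573 §1–§2 for (L3)), conclusion = the eleven clauses of ★ p863403 IN ITS BYTES
  (any open `D₁ D₂ ⊆ Pᶜ`; the consumer takes its quarter-plane domains) PLUS the closed formula of `wc` (so that `hreal` can be supplied: §3, or the adjoint functional equation for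
  self-associate `χ₁`).
* §2 **`exists_hSCAT_of_factorisation`** — EULER-ROUTE inputs instead of `d_j`: `qc_j = qcs·r_j` near `3∕2` (`r_j` analytic: normalised local intertwiners ∕ ★ (a-8) `hfac` road) and
  ONE scalar datum `d₀ = (z − 3∕2)·qcs` analytic (★ F5 `exists_residue_at_threeHalves_cm_three`), via ★ `coords_poleData_of_factorisation`.
* §3 **`hreal_of_bracket_eq_zero`** — NON-SELF-ASSOCIATE `χ₁` (`[η] = ∫ ‖x‖·χ₁ʷ conj χ₁ = 0`): the closed formula gives `wc ≡ 0`, so `hreal` holds.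
* §4 **`integrable_restrict_mul_conj_of_bounded`** — the Gram letters `hint hbb` for continuous bounded sections (`K` compact ★, Haar finite).
WHAT STAYS A LETTER (visible, named for the dealer): the exports' structural binders (`hqφ` = scattering coordinates on the tube; the data behind `(qc, P)`), the pole ledger
`D₁ ∪ D₂ ⊆ Pᶜ`, the per-coordinate data (Euler route: `hr hd₀ hd₀q hfac` = J-S8-SCAL ∕ ★ F5), `hreal` for SELF-ASSOCIATE `χ₁` ([MoeglinWaldspurger1995] IV.1.10), and — discharged in §4 for continuous bounded sections — the Gram integrability on `K` (`hint hbb`).  The instantiation at the block of record (`χ₁ := ξ.bcη⁻¹·ξ.bcψ⁻¹·μω`, `χ₂ := ξ.ψ`) is `exact` on these heads once K2E1-p12's `hSCAT` bytes are in the tree.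
HONEST LABEL: HC_CM is proved only modulo the 7 printed citations (2 remaining named inputs: hLiu418 = `stmt-HodgeConjecture-24832`, h413 = `stmt-HodgeConjecture-24833`) until rung 0
closes; REL ≠ ★ ≠ BUILT; this file asserts no named fact and closes no socket; COMPOSITION, NOT PAYMENT — every letter above stays visible; count-neutral.

## References
* [MoeglinWaldspurger1995] C. Mœglin, J.-L. Waldspurger, *Spectral Decomposition and Eisenstein Series* (1995): IV.1.9–IV.1.11, IV.2.3, IV.3.12 (a).
* [BernsteinLapid2019] J. Bernstein, E. Lapid, *On the meromorphic continuation of Eisenstein series*, J. AMS 37 (2024): Thm 2.3, §4 p. 10.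
* [Rogawski1990] J. D. Rogawski, *Automorphic Representations of Unitary Groups in Three Variables*, Ann. of Math. Stud. 123 (1990): §13.9 p. 229.
-/

set_option autoImplicit false
set_option linter.dupNamespace false -- the mandated namespace repeats `HodgeConjecture.HodgeConjecture`

noncomputable section

open MeasureTheory Measure NumberField IsDedekindDomain Set Filter Topology
open scoped ENNReal NNReal ComplexConjugate
open Literature.NumberTheory
open Literature.NumberTheory.Automorphic Literature.NumberTheory.Automorphic.UnitaryGroup Literature.NumberTheory.GaloisRepresentations AdelicGroupData
open Summit.HodgeConjecture.HodgeConjecture.Cruxes.H413.K2E1BorelEisensteinU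
open Summit.HodgeConjecture.HodgeConjecture.Cruxes.H413.K2E1CharacterEisensteinU2Defs
open Summit.HodgeConjecture.HodgeConjecture.Cruxes.H413.K2E1CharacterEisensteinU3PairDefs
open Summit.HodgeConjecture.HodgeConjecture.Cruxes.H413.K2E1ChiScatteringPairingsContinuedCMThree (wc_eq_mul_bracket differentiableOn_wc wc_agree differentiableOn_Bc_fst differentiableOn_Bc_snd_conj Bc_agree)
open Summit.HodgeConjecture.HodgeConjecture.Cruxes.H413.K2E1ChiPoleDataAtThreeHalvesOfScalarRoadCMThree (exists_analytic_mul_wc_of_coords exists_bound_normSq_mul_kernel_of_coords coords_poleData_of_factorisation)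

namespace Summit.HodgeConjecture.HodgeConjecture.Cruxes.H413.R90S8ResGMidBlockScatteringOfRecordU3

variable (L : Type) [Field L] [NumberField L] [IsCMField L]
variable [MeasurableSpace (quasiSplit (↥(maximalRealSubfield L)) L (IsCMField.complexConj L) 3).Adelic]
variable [MeasurableSpace (AdeleRing (𝓞 L) L)ˣ]

/-! ## §1 `hSCAT` from the exports tuple on a scattering basis and per-coordinate pole data -/

/-- **`hSCAT` COMPOSED**: for the `K`-Haar `μK`, the idelic Haar `νI` and idele-class domain `𝓕I`, the normalised unipotent package `(ν, 𝓕)` (`ν 𝓕 = 1`), a Hecke character `χ₁` and a section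
`φ`, a SCATTERING BASIS `φ′_j` with tube coordinates `q_j` (`hqφ`, the ★ exports' letter VERBATIM) and continued coordinates `qc_j` holomorphic on `Pᶜ`, `= q_j` on `{2 < Re}` (★ exports tuple),
open domains `D₁, D₂ ⊆ Pᶜ`, integrable Gram pairings on `K` and per-coordinate simple-pole data `d_j` at `3∕2`: THERE ARE `wc Bc d` with the eight (L2) clauses and `hd hdw hβB` of (L3) of
★ `msBound_middlePole_of_tube_letters` IN ITS BYTES, and the closed formula `wc z = (Σ_j qc_j(z)·⟨φ′_j, φ⟩_K)·∫ ‖x‖·χ₁ʷ(x)·conj χ₁(x)`.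
[cite: MoeglinWaldspurger1995, IV.2.3, IV.3.12 (a)] [cite: BernsteinLapid2019, §4 p. 10] [cite: Rogawski1990, §13.9 p. 229] -/
theorem exists_hSCAT_of_coords
    (μK : Measure ((standardMaximalCompactGL 3 L).comap (adelicVal (↥(maximalRealSubfield L)) L (IsCMField.complexConj L) 3 ((StdForm.antidiagonal 3).over L)) : Subgroup (quasiSplit (↥(maximalRealSubfield L)) L (IsCMField.complexConj L) 3).Adelic))
    (νI : Measure (AdeleRing (𝓞 L) L)ˣ) (𝓕I : Set (AdeleRing (𝓞 L) L)ˣ)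
    (ν : Measure ↥(adelicUnipotent (↥(maximalRealSubfield L)) L (IsCMField.complexConj L) 3))
    {𝓕 : Set ↥(adelicUnipotent (↥(maximalRealSubfield L)) L (IsCMField.complexConj L) 3)} (h𝓕1 : ν 𝓕 = 1)
    (χ₁ : HeckeCharacter L) (φ : (quasiSplit (↥(maximalRealSubfield L)) L (IsCMField.complexConj L) 3).Adelic → ℂ)
    {ι : Type} [Fintype ι] (φ' : ι → (quasiSplit (↥(maximalRealSubfield L)) L (IsCMField.complexConj L) 3).Adelic → ℂ) {q qc : ι → ℂ → ℂ} {P D₁ D₂ : Set ℂ}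
    (hqφ : ∀ z : ℂ, 2 < z.re → (∑ j, q j z • φ' j) = ((((ν 𝓕).toReal⁻¹ : ℝ)) : ℂ) • (fun g : (quasiSplit (↥(maximalRealSubfield L)) L (IsCMField.complexConj L) 3).Adelic => (∫ v : ↥(adelicUnipotent (↥(maximalRealSubfield L)) L (IsCMField.complexConj L) 3), flatSectionU φ z ((quasiSplit (↥(maximalRealSubfield L)) L (IsCMField.complexConj L) 3).toAdelic (weylLongU ((IsCMField.complexConj L : L ≃ₐ[↥(maximalRealSubfield L)] L) : L →+* L) (rfl : (StdForm.antidiagonal 3).over L = (StdForm.antidiagonal 3).over L)) * ((v : (quasiSplit (↥(maximalRealSubfield L)) L (IsCMField.complexConj L) 3).Adelic) * g)) ∂ν) * (((borelHeight g : ℝ) : ℂ) ^ (z - 2))))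
    (hqcP : ∀ j, DifferentiableOn ℂ (qc j) Pᶜ) (hqcq : ∀ j (z : ℂ), 2 < z.re → qc j z = q j z)
    (hD₁ : IsOpen D₁) (hD₁P : D₁ ⊆ Pᶜ) (hD₂ : IsOpen D₂) (hD₂P : D₂ ⊆ Pᶜ)
    (hint : ∀ j, Integrable (fun k : ((standardMaximalCompactGL 3 L).comap (adelicVal (↥(maximalRealSubfield L)) L (IsCMField.complexConj L) 3 ((StdForm.antidiagonal 3).over L)) : Subgroup (quasiSplit (↥(maximalRealSubfield L)) L (IsCMField.complexConj L) 3).Adelic) => φ' j (k : (quasiSplit (↥(maximalRealSubfield L)) L (IsCMField.complexConj L) 3).Adelic) * conj (φ (k : (quasiSplit (↥(maximalRealSubfield L)) L (IsCMField.complexConj L) 3).Adelic))) μK)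
    (hbb : ∀ j l, Integrable (fun k : ((standardMaximalCompactGL 3 L).comap (adelicVal (↥(maximalRealSubfield L)) L (IsCMField.complexConj L) 3 ((StdForm.antidiagonal 3).over L)) : Subgroup (quasiSplit (↥(maximalRealSubfield L)) L (IsCMField.complexConj L) 3).Adelic) => φ' j (k : (quasiSplit (↥(maximalRealSubfield L)) L (IsCMField.complexConj L) 3).Adelic) * conj (φ' l (k : (quasiSplit (↥(maximalRealSubfield L)) L (IsCMField.complexConj L) 3).Adelic))) μK)
    {dj : ι → ℂ → ℂ} (hda : ∀ j, AnalyticAt ℂ (dj j) (3 / 2 : ℂ)) (hdq : ∀ j, ∀ᶠ z in 𝓝[≠] ((3 / 2 : ℂ)), dj j z = (z - 3 / 2) * qc j z) :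
    ∃ (wc : ℂ → ℂ) (Bc : ℂ → ℂ → ℂ) (d : ℂ → ℂ),
      DifferentiableOn ℂ wc D₁ ∧ DifferentiableOn ℂ wc D₂ ∧
      (∀ s : ℂ, 2 < s.re → wc s = ∫ x in {x : (AdeleRing (𝓞 L) L)ˣ | (IdeleClassGroup.ideleNorm L x : ℝ) ≤ 1} ∩ 𝓕I, ((IdeleClassGroup.ideleNorm L x : ℝ) : ℂ) * (((reflectChar (IsCMField.complexConj L) χ₁ x : ℂˣ) : ℂ) * conj ((χ₁ x : ℂˣ) : ℂ) * (∫ k, (fun g : (quasiSplit (↥(maximalRealSubfield L)) L (IsCMField.complexConj L) 3).Adelic => (∫ v : ↥(adelicUnipotent (↥(maximalRealSubfield L)) L (IsCMField.complexConj L) 3), flatSectionU φ s ((quasiSplit (↥(maximalRealSubfield L)) L (IsCMField.complexConj L) 3).toAdelic (weylLongU ((IsCMField.complexConj L : L ≃ₐ[↥(maximalRealSubfield L)] L) : L →+* L) (rfl : (StdForm.antidiagonal 3).over L = (StdForm.antidiagonal 3).over L)) * ((v : (quasiSplit (↥(maximalRealSubfield L)) L (IsCMField.complexConj L) 3).Adelic)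 * g)) ∂ν) * ((borelHeight g : ℝ) : ℂ) ^ (s - 2)) (k : (quasiSplit (↥(maximalRealSubfield L)) L (IsCMField.complexConj L) 3).Adelic) * conj (φ (k : (quasiSplit (↥(maximalRealSubfield L)) L (IsCMField.complexConj L) 3).Adelic)) ∂μK)) ∂νI) ∧
      (∀ z' ∈ D₁, DifferentiableOn ℂ (fun z : ℂ => Bc z z') D₁) ∧ (∀ z ∈ D₁, DifferentiableOn ℂ (fun u : ℂ => Bc z (conj u)) {u : ℂ | conj u ∈ D₁}) ∧
      (∀ z' ∈ D₂, DifferentiableOn ℂ (fun z : ℂ => Bc z z') D₂) ∧ (∀ z ∈ D₂, DifferentiableOn ℂ (fun u : ℂ => Bc z (conj u)) {u : ℂ | conj u ∈ D₂}) ∧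
      (∀ s s' : ℂ, 2 < s.re → 2 < s'.re → Bc s s' = (∫ x in {x : (AdeleRing (𝓞 L) L)ˣ | (IdeleClassGroup.ideleNorm L x : ℝ) ≤ 1} ∩ 𝓕I, ((IdeleClassGroup.ideleNorm L x : ℝ) : ℂ) ∂νI) * (∫ k, (fun g : (quasiSplit (↥(maximalRealSubfield L)) L (IsCMField.complexConj L) 3).Adelic => (∫ v : ↥(adelicUnipotent (↥(maximalRealSubfield L)) L (IsCMField.complexConj L) 3), flatSectionU φ s ((quasiSplit (↥(maximalRealSubfield L)) L (IsCMField.complexConj L) 3).toAdelic (weylLongU ((IsCMField.complexConj L : L ≃ₐ[↥(maximalRealSubfield L)] L) : L →+* L) (rfl : (StdForm.antidiagonal 3).over L = (StdForm.antidiagonal 3).over L)) * ((v : (quasiSplit (↥(maximalRealSubfield L)) L (IsCMField.complexConj L) 3).Adelic) * g)) ∂ν) * ((borelHeight g : ℝ) : ℂ) ^ (s - 2)) (k : (quasiSplit (↥(maximalRealSubfield L)) L (IsCMField.complexConj L) 3).Adelic) * conj ((fun g : (quasiSplit (↥(maximalRealSubfield L)) L (IsCMField.complexConj L) 3).Adelic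 => (∫ v : ↥(adelicUnipotent (↥(maximalRealSubfield L)) L (IsCMField.complexConj L) 3), flatSectionU φ s' ((quasiSplit (↥(maximalRealSubfield L)) L (IsCMField.complexConj L) 3).toAdelic (weylLongU ((IsCMField.complexConj L : L ≃ₐ[↥(maximalRealSubfield L)] L) : L →+* L) (rfl : (StdForm.antidiagonal 3).over L = (StdForm.antidiagonal 3).over L)) * ((v : (quasiSplit (↥(maximalRealSubfield L)) L (IsCMField.complexConj L) 3).Adelic) * g)) ∂ν) * ((borelHeight g : ℝ) : ℂ) ^ (s' - 2)) (k : (quasiSplit (↥(maximalRealSubfield L)) L (IsCMField.complexConj L) 3).Adelic)) ∂μK)) ∧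
      AnalyticAt ℂ d (3 / 2 : ℂ) ∧ (∀ᶠ z in 𝓝[≠] ((3 / 2 : ℂ)), d z = (z - 3 / 2) * wc z) ∧
      (∃ B : ℝ, ∀ᶠ z in 𝓝[≠] ((3 / 2 : ℂ)), ‖z - 3 / 2‖ ^ 2 * ‖Bc z z‖ ≤ B) ∧
      (∀ z : ℂ, wc z = (∑ j, qc j z * ∫ k, φ' j (k : (quasiSplit (↥(maximalRealSubfield L)) L (IsCMField.complexConj L) 3).Adelic) * conj (φ (k : (quasiSplit (↥(maximalRealSubfield L)) L (IsCMField.complexConj L) 3).Adelic)) ∂μK) *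
        ∫ x in {x : (AdeleRing (𝓞 L) L)ˣ | (IdeleClassGroup.ideleNorm L x : ℝ) ≤ 1} ∩ 𝓕I, ((IdeleClassGroup.ideleNorm L x : ℝ) : ℂ) * (((reflectChar (IsCMField.complexConj L) χ₁ x : ℂˣ) : ℂ) * conj ((χ₁ x : ℂˣ) : ℂ)) ∂νI) := by
  -- the coordinate identity restricted to `K` (`ν 𝓕 = 1` kills the normalising factor)
  have hqK : ∀ z ∈ {z : ℂ | 2 < z.re}, (∑ j, q j z • fun k : ((standardMaximalCompactGL 3 L).comap (adelicVal (↥(maximalRealSubfield L)) L (IsCMField.complexConj L) 3 ((StdForm.antidiagonal 3).over L)) : Subgroup (quasiSplit (↥(maximalRealSubfield L)) L (IsCMField.complexConj L) 3).Adelic) => φ' j (k : (quasiSplit (↥(maximalRealSubfield L)) L (IsCMField.complexConj L) 3).Adelic)) =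
      fun k : ((standardMaximalCompactGL 3 L).comap (adelicVal (↥(maximalRealSubfield L)) L (IsCMField.complexConj L) 3 ((StdForm.antidiagonal 3).over L)) : Subgroup (quasiSplit (↥(maximalRealSubfield L)) L (IsCMField.complexConj L) 3).Adelic) => (fun g : (quasiSplit (↥(maximalRealSubfield L)) L (IsCMField.complexConj L) 3).Adelic => (∫ v : ↥(adelicUnipotent (↥(maximalRealSubfield L)) L (IsCMField.complexConj L) 3), flatSectionU φ z ((quasiSplit (↥(maximalRealSubfield L)) L (IsCMField.complexConj L) 3).toAdelic (weylLongU ((IsCMField.complexConj L : L ≃ₐ[↥(maximalRealSubfield L)] L) : L →+* L) (rfl : (StdForm.antidiagonal 3).over L = (StdForm.antidiagonal 3).over L)) * ((v : (quasiSplit (↥(maximalRealSubfield L)) L (IsCMField.complexConj L) 3).Adelic) * g)) ∂ν) * (((borelHeight g : ℝ) : ℂ) ^ (z - 2))) (k : (quasiSplit (↥(maximalRealSubfield L)) L (IsCMField.complexConj L) 3).Adelic) := by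
    intro z hz
    funext k
    have h := congrFun (hqφ z hz) (k : (quasiSplit (↥(maximalRealSubfield L)) L (IsCMField.complexConj L) 3).Adelic)
    rw [h𝓕1, ENNReal.toReal_one, inv_one, Complex.ofReal_one, one_smul] at h
    rw [Finset.sum_apply] at h ⊢
    simpa only [Pi.smul_apply, smul_eq_mul] using h
  have hqagree : ∀ j, ∀ z ∈ {z : ℂ | 2 < z.re}, qc j z = q j z := fun j z hz => hqcq j z hz
  have hqc₁ : ∀ j, DifferentiableOn ℂ (qc j) D₁ := fun j => (hqcP j).mono hD₁P
  have hqc₂ : ∀ j, DifferentiableOn ℂ (qc j) D₂ := fun j => (hqcP j).mono hD₂P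
  -- the closed formula of the candidate `wc` (★ p863516 `wc_eq_mul_bracket`) and the (L3) data over it (★ p863573 §1–§2)
  have hwc' : ∀ z : ℂ, (∫ x in {x : (AdeleRing (𝓞 L) L)ˣ | (IdeleClassGroup.ideleNorm L x : ℝ) ≤ 1} ∩ 𝓕I, ((IdeleClassGroup.ideleNorm L x : ℝ) : ℂ) *
      ((((reflectChar (IsCMField.complexConj L) χ₁ x : ℂˣ) : ℂ) * conj ((χ₁ x : ℂˣ) : ℂ)) * ∑ j, qc j z * ∫ k, φ' j (k : (quasiSplit (↥(maximalRealSubfield L)) L (IsCMField.complexConj L) 3).Adelic) * conj (φ (k : (quasiSplit (↥(maximalRealSubfield L)) L (IsCMField.complexConj L) 3).Adelic)) ∂μK) ∂νI) =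
      (∑ j, qc j z * ∫ k, φ' j (k : (quasiSplit (↥(maximalRealSubfield L)) L (IsCMField.complexConj L) 3).Adelic) * conj (φ (k : (quasiSplit (↥(maximalRealSubfield L)) L (IsCMField.complexConj L) 3).Adelic)) ∂μK) *
        ∫ x in {x : (AdeleRing (𝓞 L) L)ˣ | (IdeleClassGroup.ideleNorm L x : ℝ) ≤ 1} ∩ 𝓕I, ((IdeleClassGroup.ideleNorm L x : ℝ) : ℂ) * (((reflectChar (IsCMField.complexConj L) χ₁ x : ℂˣ) : ℂ) * conj ((χ₁ x : ℂˣ) : ℂ)) ∂νI := fun z =>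
    wc_eq_mul_bracket νI ({x : (AdeleRing (𝓞 L) L)ˣ | (IdeleClassGroup.ideleNorm L x : ℝ) ≤ 1} ∩ 𝓕I) (fun x => ((IdeleClassGroup.ideleNorm L x : ℝ) : ℂ))
      (fun x => (((reflectChar (IsCMField.complexConj L) χ₁ x : ℂˣ) : ℂ) * conj ((χ₁ x : ℂˣ) : ℂ))) (fun j => ∫ k, φ' j (k : (quasiSplit (↥(maximalRealSubfield L)) L (IsCMField.complexConj L) 3).Adelic) * conj (φ (k : (quasiSplit (↥(maximalRealSubfield L)) L (IsCMField.complexConj L) 3).Adelic)) ∂μK) z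
  obtain ⟨d, hd, hdw⟩ := exists_analytic_mul_wc_of_coords hda hdq (fun j => ∫ k, φ' j (k : (quasiSplit (↥(maximalRealSubfield L)) L (IsCMField.complexConj L) 3).Adelic) * conj (φ (k : (quasiSplit (↥(maximalRealSubfield L)) L (IsCMField.complexConj L) 3).Adelic)) ∂μK)
    (∫ x in {x : (AdeleRing (𝓞 L) L)ˣ | (IdeleClassGroup.ideleNorm L x : ℝ) ≤ 1} ∩ 𝓕I, ((IdeleClassGroup.ideleNorm L x : ℝ) : ℂ) * (((reflectChar (IsCMField.complexConj L) χ₁ x : ℂˣ) : ℂ) * conj ((χ₁ x : ℂˣ) : ℂ)) ∂νI) hwc'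
  obtain ⟨B, hB⟩ := exists_bound_normSq_mul_kernel_of_coords hda hdq (fun j l => ∫ k, φ' j (k : (quasiSplit (↥(maximalRealSubfield L)) L (IsCMField.complexConj L) 3).Adelic) * conj (φ' l (k : (quasiSplit (↥(maximalRealSubfield L)) L (IsCMField.complexConj L) 3).Adelic)) ∂μK)
    (∫ x in {x : (AdeleRing (𝓞 L) L)ˣ | (IdeleClassGroup.ideleNorm L x : ℝ) ≤ 1} ∩ 𝓕I, ((IdeleClassGroup.ideleNorm L x : ℝ) : ℂ) ∂νI)
    (Bc := fun s s' => (∫ x in {x : (AdeleRing (𝓞 L) L)ˣ | (IdeleClassGroup.ideleNorm L x : ℝ) ≤ 1} ∩ 𝓕I, ((IdeleClassGroup.ideleNorm L x : ℝ) : ℂ) ∂νI) *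
      ∑ j, ∑ l, qc j s * conj (qc l s') * ∫ k, φ' j (k : (quasiSplit (↥(maximalRealSubfield L)) L (IsCMField.complexConj L) 3).Adelic) * conj (φ' l (k : (quasiSplit (↥(maximalRealSubfield L)) L (IsCMField.complexConj L) 3).Adelic)) ∂μK) (fun z => rfl)
  refine ⟨fun s => ∫ x in {x : (AdeleRing (𝓞 L) L)ˣ | (IdeleClassGroup.ideleNorm L x : ℝ) ≤ 1} ∩ 𝓕I, ((IdeleClassGroup.ideleNorm L x : ℝ) : ℂ) *
      ((((reflectChar (IsCMField.complexConj L) χ₁ x : ℂˣ) : ℂ) * conj ((χ₁ x : ℂˣ) : ℂ)) * ∑ j, qc j s * ∫ k, φ' j (k : (quasiSplit (↥(maximalRealSubfield L)) L (IsCMField.complexConj L) 3).Adelic) * conj (φ (k : (quasiSplit (↥(maximalRealSubfield L)) L (IsCMField.complexConj L) 3).Adelic)) ∂μK) ∂νI,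
    fun s s' => (∫ x in {x : (AdeleRing (𝓞 L) L)ˣ | (IdeleClassGroup.ideleNorm L x : ℝ) ≤ 1} ∩ 𝓕I, ((IdeleClassGroup.ideleNorm L x : ℝ) : ℂ) ∂νI) *
      ∑ j, ∑ l, qc j s * conj (qc l s') * ∫ k, φ' j (k : (quasiSplit (↥(maximalRealSubfield L)) L (IsCMField.complexConj L) 3).Adelic) * conj (φ' l (k : (quasiSplit (↥(maximalRealSubfield L)) L (IsCMField.complexConj L) 3).Adelic)) ∂μK, d, ?_, ?_, ?_, ?_, ?_, ?_, ?_, ?_, hd, hdw, ⟨B, hB⟩, hwc'⟩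
  · -- (L2) `hwc₁`
    exact differentiableOn_wc μK νI _ _ _ hqc₁ (fun k : ((standardMaximalCompactGL 3 L).comap (adelicVal (↥(maximalRealSubfield L)) L (IsCMField.complexConj L) 3 ((StdForm.antidiagonal 3).over L)) : Subgroup (quasiSplit (↥(maximalRealSubfield L)) L (IsCMField.complexConj L) 3).Adelic) => φ (k : (quasiSplit (↥(maximalRealSubfield L)) L (IsCMField.complexConj L) 3).Adelic))
  · -- (L2) `hwc₂`
    exact differentiableOn_wc μK νI _ _ _ hqc₂ (fun k : ((standardMaximalCompactGL 3 L).comap (adelicVal (↥(maximalRealSubfield L)) L (IsCMField.complexConj L) 3 ((StdForm.antidiagonal 3).over L)) : Subgroup (quasiSplit (↥(maximalRealSubfield L)) L (IsCMField.complexConj L) 3).Adelic) => φ (k : (quasiSplit (↥(maximalRealSubfield L)) L (IsCMField.complexConj L) 3).Adelic))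
  · -- (L2) `hwagree`
    intro s hs
    exact wc_agree μK νI _ _ _ hqK hqagree hint hs
  · -- (L2) `hBc₁`
    intro z' _
    exact differentiableOn_Bc_fst hqc₁ _ _ z'
  · -- (L2) `hBc₂`
    intro z _
    exact differentiableOn_Bc_snd_conj hD₁ hqc₁ _ _ z
  · -- (L2) `hBc₁'`
    intro z' _
    exact differentiableOn_Bc_fst hqc₂ _ _ z'
  · -- (L2) `hBc₂'`
    intro z _
    exact differentiableOn_Bc_snd_conj hD₂ hqc₂ _ _ z
  · -- (L2) `hBagree`
    intro s s' hs hs'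
    exact Bc_agree μK hqK hqagree hbb _ hs hs'

/-! ## §2 The Euler route: the per-coordinate data from ONE scalar datum and the factorisation `qc_j = qcs·r_j` near `3∕2` -/

/-- **`hSCAT` COMPOSED, EULER-ROUTE INPUTS** (★ `coords_poleData_of_factorisation`): as `exists_hSCAT_of_coords`, with the per-coordinate data replaced by normalised local coefficients `r_j`
analytic at `3∕2`, ONE scalar simple-pole datum `d₀` analytic at `3∕2` with `d₀ = (z − 3∕2)·qcs` on a punctured neighbourhood (★ F5 `exists_residue_at_threeHalves_cm_three`'s currency),
and the factorisation `qc_j = qcs·r_j` near `3∕2` (J-S8-SCAL ∕ ★ (a-8)). [cite: MoeglinWaldspurger1995, IV.1.11] [cite: Rogawski1990, §13.9 p. 229] -/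
theorem exists_hSCAT_of_factorisation
    (μK : Measure ((standardMaximalCompactGL 3 L).comap (adelicVal (↥(maximalRealSubfield L)) L (IsCMField.complexConj L) 3 ((StdForm.antidiagonal 3).over L)) : Subgroup (quasiSplit (↥(maximalRealSubfield L)) L (IsCMField.complexConj L) 3).Adelic))
    (νI : Measure (AdeleRing (𝓞 L) L)ˣ) (𝓕I : Set (AdeleRing (𝓞 L) L)ˣ)
    (ν : Measure ↥(adelicUnipotent (↥(maximalRealSubfield L)) L (IsCMField.complexConj L) 3))
    {𝓕 : Set ↥(adelicUnipotent (↥(maximalRealSubfield L)) L (IsCMField.complexConj L) 3)} (h𝓕1 : ν 𝓕 = 1)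
    (χ₁ : HeckeCharacter L) (φ : (quasiSplit (↥(maximalRealSubfield L)) L (IsCMField.complexConj L) 3).Adelic → ℂ)
    {ι : Type} [Fintype ι] (φ' : ι → (quasiSplit (↥(maximalRealSubfield L)) L (IsCMField.complexConj L) 3).Adelic → ℂ) {q qc : ι → ℂ → ℂ} {P D₁ D₂ : Set ℂ}
    (hqφ : ∀ z : ℂ, 2 < z.re → (∑ j, q j z • φ' j) = ((((ν 𝓕).toReal⁻¹ : ℝ)) : ℂ) • (fun g : (quasiSplit (↥(maximalRealSubfield L)) L (IsCMField.complexConj L) 3).Adelic => (∫ v : ↥(adelicUnipotent (↥(maximalRealSubfield L)) L (IsCMField.complexConj L) 3), flatSectionU φ z ((quasiSplit (↥(maximalRealSubfield L)) L (IsCMField.complexConj L) 3).toAdelic (weylLongU ((IsCMField.complexConj L : L ≃ₐ[↥(maximalRealSubfield L)] L) : L →+* L) (rfl : (StdForm.antidiagonal 3).over L = (StdForm.antidiagonal 3).over L)) * ((v : (quasiSplit (↥(maximalRealSubfield L)) L (IsCMField.complexConj L) 3).Adelic) * g)) ∂ν) * (((borelHeight g : ℝ) : ℂ) ^ (z - 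2))))
    (hqcP : ∀ j, DifferentiableOn ℂ (qc j) Pᶜ) (hqcq : ∀ j (z : ℂ), 2 < z.re → qc j z = q j z)
    (hD₁ : IsOpen D₁) (hD₁P : D₁ ⊆ Pᶜ) (hD₂ : IsOpen D₂) (hD₂P : D₂ ⊆ Pᶜ)
    (hint : ∀ j, Integrable (fun k : ((standardMaximalCompactGL 3 L).comap (adelicVal (↥(maximalRealSubfield L)) L (IsCMField.complexConj L) 3 ((StdForm.antidiagonal 3).over L)) : Subgroup (quasiSplit (↥(maximalRealSubfield L)) L (IsCMField.complexConj L) 3).Adelic) => φ' j (k : (quasiSplit (↥(maximalRealSubfield L)) L (IsCMField.complexConj L) 3).Adelic) * conj (φ (k : (quasiSplit (↥(maximalRealSubfield L)) L (IsCMField.complexConj L) 3).Adelic))) μK)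
    (hbb : ∀ j l, Integrable (fun k : ((standardMaximalCompactGL 3 L).comap (adelicVal (↥(maximalRealSubfield L)) L (IsCMField.complexConj L) 3 ((StdForm.antidiagonal 3).over L)) : Subgroup (quasiSplit (↥(maximalRealSubfield L)) L (IsCMField.complexConj L) 3).Adelic) => φ' j (k : (quasiSplit (↥(maximalRealSubfield L)) L (IsCMField.complexConj L) 3).Adelic) * conj (φ' l (k : (quasiSplit (↥(maximalRealSubfield L)) L (IsCMField.complexConj L) 3).Adelic))) μK)
    {qcs d₀ : ℂ → ℂ} {r : ι → ℂ → ℂ} (hr : ∀ j, AnalyticAt ℂ (r j) (3 / 2 : ℂ)) (hd₀ : AnalyticAt ℂ d₀ (3 / 2 : ℂ))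
    (hd₀q : ∀ᶠ z in 𝓝[≠] ((3 / 2 : ℂ)), d₀ z = (z - 3 / 2) * qcs z) (hfac : ∀ j, ∀ᶠ z in 𝓝[≠] ((3 / 2 : ℂ)), qc j z = qcs z * r j z) :
    ∃ (wc : ℂ → ℂ) (Bc : ℂ → ℂ → ℂ) (d : ℂ → ℂ),
      DifferentiableOn ℂ wc D₁ ∧ DifferentiableOn ℂ wc D₂ ∧
      (∀ s : ℂ, 2 < s.re → wc s = ∫ x in {x : (AdeleRing (𝓞 L) L)ˣ | (IdeleClassGroup.ideleNorm L x : ℝ) ≤ 1} ∩ 𝓕I, ((IdeleClassGroup.ideleNorm L x : ℝ) : ℂ) * (((reflectChar (IsCMField.complexConj L) χ₁ x : ℂˣ) : ℂ) * conj ((χ₁ x : ℂˣ) : ℂ) * (∫ k, (fun g : (quasiSplit (↥(maximalRealSubfield L)) L (IsCMField.complexConj L) 3).Adelic => (∫ v : ↥(adelicUnipotent (↥(maximalRealSubfield L)) L (IsCMField.complexConj L) 3), flatSectionU φ s ((quasiSplit (↥(maximalRealSubfield L)) L (IsCMField.complexConj L) 3).toAdelic (weylLongU ((IsCMField.complexConj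 L : L ≃ₐ[↥(maximalRealSubfield L)] L) : L →+* L) (rfl : (StdForm.antidiagonal 3).over L = (StdForm.antidiagonal 3).over L)) * ((v : (quasiSplit (↥(maximalRealSubfield L)) L (IsCMField.complexConj L) 3).Adelic) * g)) ∂ν) * ((borelHeight g : ℝ) : ℂ) ^ (s - 2)) (k : (quasiSplit (↥(maximalRealSubfield L)) L (IsCMField.complexConj L) 3).Adelic) * conj (φ (k : (quasiSplit (↥(maximalRealSubfield L)) L (IsCMField.complexConj L) 3).Adelic)) ∂μK)) ∂νI) ∧
      (∀ z' ∈ D₁, DifferentiableOn ℂ (fun z : ℂ => Bc z z') D₁) ∧ (∀ z ∈ D₁, DifferentiableOn ℂ (fun u : ℂ => Bc z (conj u)) {u : ℂ | conj u ∈ D₁}) ∧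
      (∀ z' ∈ D₂, DifferentiableOn ℂ (fun z : ℂ => Bc z z') D₂) ∧ (∀ z ∈ D₂, DifferentiableOn ℂ (fun u : ℂ => Bc z (conj u)) {u : ℂ | conj u ∈ D₂}) ∧
      (∀ s s' : ℂ, 2 < s.re → 2 < s'.re → Bc s s' = (∫ x in {x : (AdeleRing (𝓞 L) L)ˣ | (IdeleClassGroup.ideleNorm L x : ℝ) ≤ 1} ∩ 𝓕I, ((IdeleClassGroup.ideleNorm L x : ℝ) : ℂ) ∂νI) * (∫ k, (fun g : (quasiSplit (↥(maximalRealSubfield L)) L (IsCMField.complexConj L) 3).Adelic => (∫ v : ↥(adelicUnipotent (↥(maximalRealSubfield L)) L (IsCMField.complexConj L) 3), flatSectionU φ s ((quasiSplit (↥(maximalRealSubfield L)) L (IsCMField.complexConj L) 3).toAdelic (weylLongU ((IsCMField.complexConj L : L ≃ₐ[↥(maximalRealSubfield L)] L) : L →+* L) (rfl : (StdForm.antidiagonal 3).over L = (StdForm.antidiagonal 3).over L)) * ((v : (quasiSplit (↥(maximalRealSubfield L)) L (IsCMField.complexConj L) 3).Adelic) * g)) ∂ν) * ((borelHeight g : ℝ)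 : ℂ) ^ (s - 2)) (k : (quasiSplit (↥(maximalRealSubfield L)) L (IsCMField.complexConj L) 3).Adelic) * conj ((fun g : (quasiSplit (↥(maximalRealSubfield L)) L (IsCMField.complexConj L) 3).Adelic => (∫ v : ↥(adelicUnipotent (↥(maximalRealSubfield L)) L (IsCMField.complexConj L) 3), flatSectionU φ s' ((quasiSplit (↥(maximalRealSubfield L)) L (IsCMField.complexConj L) 3).toAdelic (weylLongU ((IsCMField.complexConj L : L ≃ₐ[↥(maximalRealSubfield L)] L) : L →+* L) (rfl : (StdForm.antidiagonal 3).over L = (StdForm.antidiagonal 3).over L)) * ((v : (quasiSplit (↥(maximalRealSubfield L)) L (IsCMField.complexConj L) 3).Adelic) * g)) ∂ν) * ((borelHeight g : ℝ) : ℂ) ^ (s' - 2)) (k : (quasiSplit (↥(maximalRealSubfield L)) L (IsCMField.complexConj L) 3).Adelic)) ∂μK)) ∧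
      AnalyticAt ℂ d (3 / 2 : ℂ) ∧ (∀ᶠ z in 𝓝[≠] ((3 / 2 : ℂ)), d z = (z - 3 / 2) * wc z) ∧
      (∃ B : ℝ, ∀ᶠ z in 𝓝[≠] ((3 / 2 : ℂ)), ‖z - 3 / 2‖ ^ 2 * ‖Bc z z‖ ≤ B) ∧
      (∀ z : ℂ, wc z = (∑ j, qc j z * ∫ k, φ' j (k : (quasiSplit (↥(maximalRealSubfield L)) L (IsCMField.complexConj L) 3).Adelic) * conj (φ (k : (quasiSplit (↥(maximalRealSubfield L)) L (IsCMField.complexConj L) 3).Adelic)) ∂μK) *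
        ∫ x in {x : (AdeleRing (𝓞 L) L)ˣ | (IdeleClassGroup.ideleNorm L x : ℝ) ≤ 1} ∩ 𝓕I, ((IdeleClassGroup.ideleNorm L x : ℝ) : ℂ) * (((reflectChar (IsCMField.complexConj L) χ₁ x : ℂˣ) : ℂ) * conj ((χ₁ x : ℂˣ) : ℂ)) ∂νI) := by
  obtain ⟨hda, hdq⟩ := coords_poleData_of_factorisation (qc := qc) hr hd₀ hd₀q hfac
  exact exists_hSCAT_of_coords L μK νI 𝓕I ν h𝓕1 χ₁ φ φ' hqφ hqcP hqcq hD₁ hD₁P hD₂ hD₂P hint hbb hda hdq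

/-! ## §3 The non-self-associate case: `[η] = 0` gives `hreal` (and `wc ≡ 0`) from the closed formula -/

/-- **`hreal` FOR NON-SELF-ASSOCIATE `χ₁`**: if the bracket `[η] = ∫_{‖x‖≤1 ∩ 𝓕_I} ‖x‖·χ₁ʷ(x) conj χ₁(x) dνI` VANISHES (`χ₁ʷ ≠ χ₁`: orthogonality of idele-class characters) then any `wc` with the
closed formula of `exists_hSCAT_of_coords` is identically `0`; in particular `wc` is real on the punctured real axis at `3∕2` — the `hreal` letter of ★ p863403.
[cite: MoeglinWaldspurger1995, IV.1.10] -/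
theorem hreal_of_bracket_eq_zero
    (μK : Measure ((standardMaximalCompactGL 3 L).comap (adelicVal (↥(maximalRealSubfield L)) L (IsCMField.complexConj L) 3 ((StdForm.antidiagonal 3).over L)) : Subgroup (quasiSplit (↥(maximalRealSubfield L)) L (IsCMField.complexConj L) 3).Adelic))
    (νI : Measure (AdeleRing (𝓞 L) L)ˣ) (𝓕I : Set (AdeleRing (𝓞 L) L)ˣ) (χ₁ : HeckeCharacter L) (φ : (quasiSplit (↥(maximalRealSubfield L)) L (IsCMField.complexConj L) 3).Adelic → ℂ)
    {ι : Type} [Fintype ι] (φ' : ι → (quasiSplit (↥(maximalRealSubfield L)) L (IsCMField.complexConj L) 3).Adelic → ℂ) (qc : ι → ℂ → ℂ) {wc : ℂ → ℂ}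
    (hwc : ∀ z : ℂ, wc z = (∑ j, qc j z * ∫ k, φ' j (k : (quasiSplit (↥(maximalRealSubfield L)) L (IsCMField.complexConj L) 3).Adelic) * conj (φ (k : (quasiSplit (↥(maximalRealSubfield L)) L (IsCMField.complexConj L) 3).Adelic)) ∂μK) *
        ∫ x in {x : (AdeleRing (𝓞 L) L)ˣ | (IdeleClassGroup.ideleNorm L x : ℝ) ≤ 1} ∩ 𝓕I, ((IdeleClassGroup.ideleNorm L x : ℝ) : ℂ) * (((reflectChar (IsCMField.complexConj L) χ₁ x : ℂˣ) : ℂ) * conj ((χ₁ x : ℂˣ) : ℂ)) ∂νI)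
    (hη : (∫ x in {x : (AdeleRing (𝓞 L) L)ˣ | (IdeleClassGroup.ideleNorm L x : ℝ) ≤ 1} ∩ 𝓕I, ((IdeleClassGroup.ideleNorm L x : ℝ) : ℂ) * (((reflectChar (IsCMField.complexConj L) χ₁ x : ℂˣ) : ℂ) * conj ((χ₁ x : ℂˣ) : ℂ)) ∂νI) = 0) :
    (∀ z : ℂ, wc z = 0) ∧ ∀ᶠ x : ℝ in 𝓝[≠] (3 / 2 : ℝ), (wc (x : ℂ)).im = 0 := by
  have h0 : ∀ z : ℂ, wc z = 0 := fun z => by rw [hwc z, hη, mul_zero]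
  exact ⟨h0, Eventually.of_forall fun x => by rw [h0]; rfl⟩

/-! ## §4 The Gram pairings on the compact `K` are integrable (the letters `hint hbb` discharged from continuity and bounds) -/

omit [MeasurableSpace (AdeleRing (𝓞 L) L)ˣ] in
/-- **`k ↦ f(k)·conj g(k)` IS `μK`-INTEGRABLE ON `K`** for continuous bounded `f g : G(𝔸) → ℂ` and a Haar measure `μK` on the (compact, ★ `isCompact_comap_adelicVal_standardMaximalCompactGL`)
maximal compact subgroup `K` — the letters `hint` (`f := φ′_j`, `g := φ`) and `hbb` (`f := φ′_j`, `g := φ′_l`) of §1 for continuous bounded sections. [folklore] -/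
theorem integrable_restrict_mul_conj_of_bounded [BorelSpace (quasiSplit (↥(maximalRealSubfield L)) L (IsCMField.complexConj L) 3).Adelic]
    (μK : Measure ((standardMaximalCompactGL 3 L).comap (adelicVal (↥(maximalRealSubfield L)) L (IsCMField.complexConj L) 3 ((StdForm.antidiagonal 3).over L)) : Subgroup (quasiSplit (↥(maximalRealSubfield L)) L (IsCMField.complexConj L) 3).Adelic)) [μK.IsHaarMeasure]
    {f g : (quasiSplit (↥(maximalRealSubfield L)) L (IsCMField.complexConj L) 3).Adelic → ℂ} (hf : Continuous f) (hg : Continuous g) {Cf Cg : ℝ} (hCf : ∀ x, ‖f x‖ ≤ Cf) (hCg : ∀ x, ‖g x‖ ≤ Cg) :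
    Integrable (fun k : ((standardMaximalCompactGL 3 L).comap (adelicVal (↥(maximalRealSubfield L)) L (IsCMField.complexConj L) 3 ((StdForm.antidiagonal 3).over L)) : Subgroup (quasiSplit (↥(maximalRealSubfield L)) L (IsCMField.complexConj L) 3).Adelic) => f (k : (quasiSplit (↥(maximalRealSubfield L)) L (IsCMField.complexConj L) 3).Adelic) * conj (g (k : (quasiSplit (↥(maximalRealSubfield L)) L (IsCMField.complexConj L) 3).Adelic))) μK := by
  haveI : CompactSpace ((standardMaximalCompactGL 3 L).comap (adelicVal (↥(maximalRealSubfield L)) L (IsCMField.complexConj L) 3 ((StdForm.antidiagonal 3).over L)) : Subgroup (quasiSplit (↥(maximalRealSubfield L)) L (IsCMField.complexConj L) 3).Adelic) :=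
    isCompact_iff_compactSpace.1 (isCompact_comap_adelicVal_standardMaximalCompactGL (F := ↥(maximalRealSubfield L)) (E := L) (c := IsCMField.complexConj L) (N := 3))
  haveI : IsFiniteMeasure μK := ⟨isCompact_univ.measure_lt_top⟩
  have hm : AEStronglyMeasurable (fun k : ((standardMaximalCompactGL 3 L).comap (adelicVal (↥(maximalRealSubfield L)) L (IsCMField.complexConj L) 3 ((StdForm.antidiagonal 3).over L)) : Subgroup (quasiSplit (↥(maximalRealSubfield L)) L (IsCMField.complexConj L) 3).Adelic) => f (k : (quasiSplit (↥(maximalRealSubfield L)) L (IsCMField.complexConj L) 3).Adelic) * conj (g (k : (quasiSplit (↥(maximalRealSubfield L)) L (IsCMField.complexConj L) 3).Adelic))) μK :=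
    ((hf.comp continuous_subtype_val).mul (Complex.continuous_conj.comp (hg.comp continuous_subtype_val))).aestronglyMeasurable
  refine (integrable_const (Cf * Cg)).mono' hm (Eventually.of_forall fun k => ?_)
  rw [norm_mul, Complex.norm_conj]
  exact mul_le_mul (hCf _) (hCg _) (norm_nonneg _) ((norm_nonneg (f (k : (quasiSplit (↥(maximalRealSubfield L)) L (IsCMField.complexConj L) 3).Adelic))).trans (hCf (k : (quasiSplit (↥(maximalRealSubfield L)) L (IsCMField.complexConj L) 3).Adelic)))


/-! ## §5 (ED. 2) `hSCAT` OF THE ℓ-ROAD AT THE BLOCK OF RECORD — the binder bytes of ★ p863731 `res_midBlock_le_residual_of_letters‴` from the scattering letters -/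

section OfRecord

open Literature.NumberTheory.Automorphic.Arthur2013.Leaves.TECR Literature.NumberTheory.Rogawski1990 ContRepresentation
open Summit.HodgeConjecture.HodgeConjecture.Cruxes.H413.K2E1ChiSectionSpaceU3PairDefs

/-- **`hSCAT` OF K2E1-p12's ℓ-ROAD ★ p863731 AT THE MID BLOCK OF RECORD, FROM THE SCATTERING LETTERS.**  CONCLUSION: the TYPE of the binder `hSCAT` of ★
`Summit.HodgeConjecture.HodgeConjecture.R90.S8.res_midBlock_le_residual_of_letters‴` BYTE FOR BYTE (`χ₁ := ξ.bcη⁻¹·ξ.bcψ⁻¹·μω`, `φ ∈ V(χ₁, ξ.ψ; K′, ω)`, the normalised Heisenberg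
package, `D⁺ = {1 < Re ∧ 0 < Im}`, `D⁻ = {1 < Re ∧ Im < 0}`; then `∀ μK νI 𝓕I, ∃ wc Bc d, (L2) ∧ (L3)`).  HYPOTHESIS `hX` (the SCATTERING LETTERS, quantified over the SAME frame): for every
frame a finite SCATTERING BASIS `φ′_j` (continuous, uniformly bounded) with TUBE COORDINATES `q_j` (the ★ exports' `hqφ` bytes), CONTINUED COORDINATES `qc_j` holomorphic off `P` and `= q_j`
on the tube, the POLE LEDGER `D± ⊆ Pᶜ`, PER-COORDINATE SIMPLE-POLE DATA `d_j` at `3∕2`, and the REALITY INPUT (for every `μK νI 𝓕I` the closed formula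
`(Σ_j qc_j(x)·⟨φ′_j, φ⟩_K)·[η]` is real on the punctured axis at `3∕2` — free when `[η] = 0`, ★ `hreal_of_bracket_eq_zero`; the adjoint functional equation for self-associate `χ₁`).
PROOF: §4 discharges the Gram integrability (★ `exists_bound_of_mem_chiSectionSpacePair_midBlock` bounds `φ`), §1 `exists_hSCAT_of_coords` gives the eleven clauses + the closed formula,
and the reality input is transported along the formula. [cite: MoeglinWaldspurger1995, IV.2.3, IV.3.12 (a)] [cite: BernsteinLapid2019, §4 p. 10] [cite: Rogawski1990, §13.9 p. 229] -/
theorem hSCAT_of_scatteringLetters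
    (hX : ∀ (L : Type) [Field L] [NumberField L] [IsCMField L]
      [MeasurableSpace (quasiSplit (↥(maximalRealSubfield L)) L (IsCMField.complexConj L) 3).Adelic] [BorelSpace (quasiSplit (↥(maximalRealSubfield L)) L (IsCMField.complexConj L) 3).Adelic] [MeasurableSpace (AdeleRing (𝓞 L) L)ˣ] [BorelSpace (AdeleRing (𝓞 L) L)ˣ]
      (μ : Measure (quasiSplit (↥(maximalRealSubfield L)) L (IsCMField.complexConj L) 3).automorphicQuotient) [(quasiSplit (↥(maximalRealSubfield L)) L (IsCMField.complexConj L) 3).IsAutomorphicMeasure μ]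
      (𝔓 : (quasiSplit (↥(maximalRealSubfield L)) L (IsCMField.complexConj L) 3).ParabolicUnipotentData) (_ : ∀ j : 𝔓.ι, 𝔓.radical j = adelicUnipotent (↥(maximalRealSubfield L)) L (IsCMField.complexConj L) 3)
      (μω : HeckeCharacter L) (_ : μω.IsUnitary)
      (_ : ∀ x : Literature.NumberTheory.GaloisRepresentations.ideleGroup ↥(maximalRealSubfield L),
        μω (AdeleRing.ideleBaseChange (↥(maximalRealSubfield L)) L x) = quadraticHeckeCharCM L x)
      (ξ : OneDimAutRepH L) (K' : Subgroup (quasiSplit (↥(maximalRealSubfield L)) L (IsCMField.complexConj L) 3).Adelic) (ω : ↥K' →* ℂ)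
      (φ : (quasiSplit (↥(maximalRealSubfield L)) L (IsCMField.complexConj L) 3).Adelic → ℂ) (_ : φ ∈ chiSectionSpacePair (ξ.bcη⁻¹ * ξ.bcψ⁻¹ * μω) ξ.ψ K' (ω : ↥K' → ℂ)) (_ : Continuous φ)
      (Ec : ℂ → (quasiSplit (↥(maximalRealSubfield L)) L (IsCMField.complexConj L) 3).Adelic → ℂ) (Sp : Finset ℂ) (_ : ∀ s ∈ Sp, s.im = 0 ∧ 1 < s.re ∧ s.re ≤ 2)
      (_ : ∀ g, DifferentiableOn ℂ (fun z => Ec z g) ({z : ℂ | 1 < z.re} \ (↑Sp : Set ℂ)))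
      (_ : ∀ z : ℂ, 2 < z.re → Ec z = eisensteinSeriesU (flatSectionU φ z))
      (Fp : (quasiSplit (↥(maximalRealSubfield L)) L (IsCMField.complexConj L) 3).Adelic → ℂ → ℂ) (_ : ∀ g, AnalyticAt ℂ (Fp g) ((3 : ℂ) / 2))
      (_ : ∀ g, Fp g =ᶠ[𝓝[≠] ((3 : ℂ) / 2)] fun z => (z - (3 : ℂ) / 2) * Ec z g)
      (f : (quasiSplit (↥(maximalRealSubfield L)) L (IsCMField.complexConj L) 3).L2 μ) (_ : (f : (quasiSplit (↥(maximalRealSubfield L)) L (IsCMField.complexConj L) 3).automorphicQuotient → ℂ) =ᵐ[μ] fun x => Fp (Quotient.out (x : (quasiSplit (↥(maximalRealSubfield L)) L (IsCMField.complexConj L) 3).Adelic ⧸ (quasiSplit (↥(maximalRealSubfield L)) L (IsCMField.complexConj L) 3).quotientSubgroup))⁻¹ ((3 : ℂ) / 2))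
      (ν : Measure ↥(adelicUnipotent (↥(maximalRealSubfield L)) L (IsCMField.complexConj L) 3)) (_ : ν.IsHaarMeasure) (𝓕 : Set ↥(adelicUnipotent (↥(maximalRealSubfield L)) L (IsCMField.complexConj L) 3)) (_ : IsFundamentalDomain ↥(rationalUnipotent (↥(maximalRealSubfield L)) L (IsCMField.complexConj L) 3) 𝓕 ν) (_ : IsCompact (closure 𝓕)) (_ : ν.IsInvInvariant) (_ : ν 𝓕 = 1),
      ∃ (ι : Type) (_ : Fintype ι) (φ' : ι → (quasiSplit (↥(maximalRealSubfield L)) L (IsCMField.complexConj L) 3).Adelic → ℂ) (q qc : ι → ℂ → ℂ) (P : Set ℂ) (dj : ι → ℂ → ℂ) (M : ℝ),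
        (∀ z : ℂ, 2 < z.re → (∑ j, q j z • φ' j) = ((((ν 𝓕).toReal⁻¹ : ℝ)) : ℂ) • (fun g : (quasiSplit (↥(maximalRealSubfield L)) L (IsCMField.complexConj L) 3).Adelic => (∫ v : ↥(adelicUnipotent (↥(maximalRealSubfield L)) L (IsCMField.complexConj L) 3), flatSectionU φ z ((quasiSplit (↥(maximalRealSubfield L)) L (IsCMField.complexConj L) 3).toAdelic (weylLongU ((IsCMField.complexConj L : L ≃ₐ[↥(maximalRealSubfield L)] L) : L →+* L) (rfl : (StdForm.antidiagonal 3).over L = (StdForm.antidiagonal 3).over L)) * ((v : (quasiSplit (↥(maximalRealSubfield L)) L (IsCMField.complexConj L) 3).Adelic) * g)) ∂ν) * (((borelHeight g : ℝ) : ℂ) ^ (z - 2)))) ∧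
        (∀ j, DifferentiableOn ℂ (qc j) Pᶜ) ∧ (∀ j (z : ℂ), 2 < z.re → qc j z = q j z) ∧
        ({z : ℂ | 1 < z.re ∧ 0 < z.im} ⊆ Pᶜ) ∧ ({z : ℂ | 1 < z.re ∧ z.im < 0} ⊆ Pᶜ) ∧
        (∀ j, Continuous (φ' j)) ∧ (∀ j x, ‖φ' j x‖ ≤ M) ∧
        (∀ j, AnalyticAt ℂ (dj j) (3 / 2 : ℂ)) ∧ (∀ j, ∀ᶠ z in 𝓝[≠] ((3 / 2 : ℂ)), dj j z = (z - 3 / 2) * qc j z) ∧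
        (∀ (μK : Measure ↥((standardMaximalCompactGL 3 L).comap (adelicVal (↥(maximalRealSubfield L)) L (IsCMField.complexConj L) 3 ((StdForm.antidiagonal 3).over L)) : Subgroup (quasiSplit (↥(maximalRealSubfield L)) L (IsCMField.complexConj L) 3).Adelic)) (_ : μK.IsHaarMeasure) (νI : Measure (AdeleRing (𝓞 L) L)ˣ) (_ : νI.IsHaarMeasure) (𝓕I : Set (AdeleRing (𝓞 L) L)ˣ) (_ : IsIdeleClassDomain L 𝓕I),
          ∀ᶠ x : ℝ in 𝓝[≠] (3 / 2 : ℝ), (((∑ j, qc j (x : ℂ) * ∫ k, φ' j (k : (quasiSplit (↥(maximalRealSubfield L)) L (IsCMField.complexConj L) 3).Adelic) * conj (φ (k : (quasiSplit (↥(maximalRealSubfield L)) L (IsCMField.complexConj L) 3).Adelic)) ∂μK) *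
            ∫ x in {x : (AdeleRing (𝓞 L) L)ˣ | (IdeleClassGroup.ideleNorm L x : ℝ) ≤ 1} ∩ 𝓕I, ((IdeleClassGroup.ideleNorm L x : ℝ) : ℂ) * (((reflectChar (IsCMField.complexConj L) (ξ.bcη⁻¹ * ξ.bcψ⁻¹ * μω) x : ℂˣ) : ℂ) * conj (((ξ.bcη⁻¹ * ξ.bcψ⁻¹ * μω) x : ℂˣ) : ℂ)) ∂νI) : ℂ).im = 0)) :
    ∀ (L : Type) [Field L] [NumberField L] [IsCMField L]
      [MeasurableSpace (quasiSplit (↥(maximalRealSubfield L)) L (IsCMField.complexConj L) 3).Adelic] [BorelSpace (quasiSplit (↥(maximalRealSubfield L)) L (IsCMField.complexConj L) 3).Adelic] [MeasurableSpace (AdeleRing (𝓞 L) L)ˣ] [BorelSpace (AdeleRing (𝓞 L) L)ˣ]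
      (μ : Measure (quasiSplit (↥(maximalRealSubfield L)) L (IsCMField.complexConj L) 3).automorphicQuotient) [(quasiSplit (↥(maximalRealSubfield L)) L (IsCMField.complexConj L) 3).IsAutomorphicMeasure μ]
      (𝔓 : (quasiSplit (↥(maximalRealSubfield L)) L (IsCMField.complexConj L) 3).ParabolicUnipotentData) (_ : ∀ j : 𝔓.ι, 𝔓.radical j = adelicUnipotent (↥(maximalRealSubfield L)) L (IsCMField.complexConj L) 3)
      (μω : HeckeCharacter L) (_ : μω.IsUnitary)
      (_ : ∀ x : Literature.NumberTheory.GaloisRepresentations.ideleGroup ↥(maximalRealSubfield L),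
        μω (AdeleRing.ideleBaseChange (↥(maximalRealSubfield L)) L x) = quadraticHeckeCharCM L x)
      (ξ : OneDimAutRepH L) (K' : Subgroup (quasiSplit (↥(maximalRealSubfield L)) L (IsCMField.complexConj L) 3).Adelic) (ω : ↥K' →* ℂ)
      (φ : (quasiSplit (↥(maximalRealSubfield L)) L (IsCMField.complexConj L) 3).Adelic → ℂ) (_ : φ ∈ chiSectionSpacePair (ξ.bcη⁻¹ * ξ.bcψ⁻¹ * μω) ξ.ψ K' (ω : ↥K' → ℂ)) (_ : Continuous φ)
      (Ec : ℂ → (quasiSplit (↥(maximalRealSubfield L)) L (IsCMField.complexConj L) 3).Adelic → ℂ) (Sp : Finset ℂ) (_ : ∀ s ∈ Sp, s.im = 0 ∧ 1 < s.re ∧ s.re ≤ 2)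
      (_ : ∀ g, DifferentiableOn ℂ (fun z => Ec z g) ({z : ℂ | 1 < z.re} \ (↑Sp : Set ℂ)))
      (_ : ∀ z : ℂ, 2 < z.re → Ec z = eisensteinSeriesU (flatSectionU φ z))
      (Fp : (quasiSplit (↥(maximalRealSubfield L)) L (IsCMField.complexConj L) 3).Adelic → ℂ → ℂ) (_ : ∀ g, AnalyticAt ℂ (Fp g) ((3 : ℂ) / 2))
      (_ : ∀ g, Fp g =ᶠ[𝓝[≠] ((3 : ℂ) / 2)] fun z => (z - (3 : ℂ) / 2) * Ec z g)
      (f : (quasiSplit (↥(maximalRealSubfield L)) L (IsCMField.complexConj L) 3).L2 μ) (_ : (f : (quasiSplit (↥(maximalRealSubfield L)) L (IsCMField.complexConj L) 3).automorphicQuotient → ℂ) =ᵐ[μ] fun x => Fp (Quotient.out (x : (quasiSplit (↥(maximalRealSubfield L)) L (IsCMField.complexConj L) 3).Adelic ⧸ (quasiSplit (↥(maximalRealSubfield L)) L (IsCMField.complexConj L) 3).quotientSubgroup))⁻¹ ((3 : ℂ) / 2))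
      (ν : Measure ↥(adelicUnipotent (↥(maximalRealSubfield L)) L (IsCMField.complexConj L) 3)) (_ : ν.IsHaarMeasure) (𝓕 : Set ↥(adelicUnipotent (↥(maximalRealSubfield L)) L (IsCMField.complexConj L) 3)) (_ : IsFundamentalDomain ↥(rationalUnipotent (↥(maximalRealSubfield L)) L (IsCMField.complexConj L) 3) 𝓕 ν) (_ : IsCompact (closure 𝓕)) (_ : ν.IsInvInvariant) (_ : ν 𝓕 = 1),
      ∀ (μK : Measure ↥((standardMaximalCompactGL 3 L).comap (adelicVal (↥(maximalRealSubfield L)) L (IsCMField.complexConj L) 3 ((StdForm.antidiagonal 3).over L)) : Subgroup (quasiSplit (↥(maximalRealSubfield L)) L (IsCMField.complexConj L) 3).Adelic)) (_ : μK.IsHaarMeasure) (νI : Measure (AdeleRing (𝓞 L) L)ˣ) (_ : νI.IsHaarMeasure) (𝓕I : Set (AdeleRing (𝓞 L) L)ˣ) (_ : IsIdeleClassDomain L 𝓕I),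
        ∃ (wc : ℂ → ℂ) (Bc : ℂ → ℂ → ℂ) (d : ℂ → ℂ),
          DifferentiableOn ℂ wc {z : ℂ | 1 < z.re ∧ 0 < z.im} ∧ DifferentiableOn ℂ wc {z : ℂ | 1 < z.re ∧ z.im < 0} ∧ (∀ s : ℂ, 2 < s.re → wc s = ∫ x in {x : (AdeleRing (𝓞 L) L)ˣ | (IdeleClassGroup.ideleNorm L x : ℝ) ≤ 1} ∩ 𝓕I, ((IdeleClassGroup.ideleNorm L x : ℝ) : ℂ) * (((reflectChar (IsCMField.complexConj L) (ξ.bcη⁻¹ * ξ.bcψ⁻¹ * μω) x : ℂˣ) : ℂ) * conj (((ξ.bcη⁻¹ * ξ.bcψ⁻¹ * μω) x : ℂˣ) : ℂ) * (∫ k, (fun g : (quasiSplit (↥(maximalRealSubfield L)) L (IsCMField.complexConj L) 3).Adelic => (∫ v : ↥(adelicUnipotent (↥(maximalRealSubfield L)) L (IsCMField.complexConj L) 3), flatSectionU φ s ((quasiSplit (↥(maximalRealSubfield L)) L (IsCMField.complexConj L) 3).toAdelic (weylLongU ((IsCMField.complexConj L : L ≃ₐ[↥(maximalRealSubfield L)]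 L) : L →+* L) (rfl : (StdForm.antidiagonal 3).over L = (StdForm.antidiagonal 3).over L)) * ((v : (quasiSplit (↥(maximalRealSubfield L)) L (IsCMField.complexConj L) 3).Adelic) * g)) ∂ν) * ((borelHeight g : ℝ) : ℂ) ^ (s - 2)) (k : (quasiSplit (↥(maximalRealSubfield L)) L (IsCMField.complexConj L) 3).Adelic) * conj (φ (k : (quasiSplit (↥(maximalRealSubfield L)) L (IsCMField.complexConj L) 3).Adelic)) ∂μK)) ∂νI) ∧
          (∀ z' ∈ {z : ℂ | 1 < z.re ∧ 0 < z.im}, DifferentiableOn ℂ (fun z : ℂ => Bc z z') {z : ℂ | 1 < z.re ∧ 0 < z.im}) ∧ (∀ z ∈ {z : ℂ | 1 < z.re ∧ 0 < z.im}, DifferentiableOn ℂ (fun u : ℂ => Bc z (conj u)) {u : ℂ | conj u ∈ {z : ℂ | 1 < z.re ∧ 0 < z.im}}) ∧ (∀ z' ∈ {z : ℂ | 1 < z.re ∧ z.im < 0}, DifferentiableOn ℂ (fun z : ℂ => Bc z z') {z : ℂ | 1 < z.re ∧ z.im < 0}) ∧ (∀ z ∈ {z : ℂ | 1 < z.re ∧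 z.im < 0}, DifferentiableOn ℂ (fun u : ℂ => Bc z (conj u)) {u : ℂ | conj u ∈ {z : ℂ | 1 < z.re ∧ z.im < 0}}) ∧ (∀ s s' : ℂ, 2 < s.re → 2 < s'.re → Bc s s' = (∫ x in {x : (AdeleRing (𝓞 L) L)ˣ | (IdeleClassGroup.ideleNorm L x : ℝ) ≤ 1} ∩ 𝓕I, ((IdeleClassGroup.ideleNorm L x : ℝ) : ℂ) ∂νI) * (∫ k, (fun g : (quasiSplit (↥(maximalRealSubfield L)) L (IsCMField.complexConj L) 3).Adelic => (∫ v : ↥(adelicUnipotent (↥(maximalRealSubfield L)) L (IsCMField.complexConj L) 3), flatSectionU φ s ((quasiSplit (↥(maximalRealSubfield L)) L (IsCMField.complexConj L) 3).toAdelic (weylLongU ((IsCMField.complexConj L : L ≃ₐ[↥(maximalRealSubfield L)] L) : L →+* L) (rfl : (StdForm.antidiagonal 3).over L = (StdForm.antidiagonal 3).over L)) * ((v : (quasiSplit (↥(maximalRealSubfield L)) L (IsCMField.complexConj L) 3).Adelic) * g)) ∂ν) * ((borelHeight g : ℝ) : ℂ) ^ (s - 2)) (k : (quasiSplit (↥(maximalRealSubfield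 L)) L (IsCMField.complexConj L) 3).Adelic) * conj ((fun g : (quasiSplit (↥(maximalRealSubfield L)) L (IsCMField.complexConj L) 3).Adelic => (∫ v : ↥(adelicUnipotent (↥(maximalRealSubfield L)) L (IsCMField.complexConj L) 3), flatSectionU φ s' ((quasiSplit (↥(maximalRealSubfield L)) L (IsCMField.complexConj L) 3).toAdelic (weylLongU ((IsCMField.complexConj L : L ≃ₐ[↥(maximalRealSubfield L)] L) : L →+* L) (rfl : (StdForm.antidiagonal 3).over L = (StdForm.antidiagonal 3).over L)) * ((v : (quasiSplit (↥(maximalRealSubfield L)) L (IsCMField.complexConj L) 3).Adelic) * g)) ∂ν) * ((borelHeight g : ℝ) : ℂ) ^ (s' - 2)) (k : (quasiSplit (↥(maximalRealSubfield L)) L (IsCMField.complexConj L) 3).Adelic)) ∂μK)) ∧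
          (AnalyticAt ℂ d (3 / 2 : ℂ)) ∧ (∀ᶠ z in 𝓝[≠] ((3 / 2 : ℂ)), d z = (z - 3 / 2) * wc z) ∧ (∀ᶠ x : ℝ in 𝓝[≠] (3 / 2 : ℝ), (wc (x : ℂ)).im = 0) ∧ (∃ B : ℝ, ∀ᶠ z in 𝓝[≠] ((3 / 2 : ℂ)), ‖z - 3 / 2‖ ^ 2 * ‖Bc z z‖ ≤ B) := by
  intro L _ _ _ _ _ _ _ μ _ 𝔓 h𝔓 μω hμu hquad ξ K' ω φ hφV hφc Ec Sp hSp hhol hEis Fp hFp hFpE f hf ν hν 𝓕 h𝓕N h𝓕c hνinv hν1 μK hμK νI hνI 𝓕I h𝓕I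
  obtain ⟨ι, hι, φ', q, qc, P, dj, M, hqφ, hqcP, hqcq, hD₁P, hD₂P, hφ'c, hφ'M, hda, hdq, hrealIn⟩ :=
    hX L μ 𝔓 h𝔓 μω hμu hquad ξ K' ω φ hφV hφc Ec Sp hSp hhol hEis Fp hFp hFpE f hf ν hν 𝓕 h𝓕N h𝓕c hνinv hν1
  obtain ⟨Cφ, hφC⟩ := Summit.HodgeConjecture.HodgeConjecture.R90.S8.exists_bound_of_mem_chiSectionSpacePair_midBlock L ξ hμu hφV hφc
  haveI := hμK
  have hD₁ : IsOpen {z : ℂ | 1 < z.re ∧ 0 < z.im} := (isOpen_lt continuous_const Complex.continuous_re).inter (isOpen_lt continuous_const Complex.continuous_im)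
  have hD₂ : IsOpen {z : ℂ | 1 < z.re ∧ z.im < 0} := (isOpen_lt continuous_const Complex.continuous_re).inter (isOpen_lt Complex.continuous_im continuous_const)
  have hint : ∀ j, Integrable (fun k : ↥((standardMaximalCompactGL 3 L).comap (adelicVal (↥(maximalRealSubfield L)) L (IsCMField.complexConj L) 3 ((StdForm.antidiagonal 3).over L)) : Subgroup (quasiSplit (↥(maximalRealSubfield L)) L (IsCMField.complexConj L) 3).Adelic) => φ' j (k : (quasiSplit (↥(maximalRealSubfield L)) L (IsCMField.complexConj L) 3).Adelic) * conj (φ (k : (quasiSplit (↥(maximalRealSubfield L)) L (IsCMField.complexConj L) 3).Adelic))) μK := fun j =>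
    integrable_restrict_mul_conj_of_bounded L μK (hφ'c j) hφc (hφ'M j) hφC
  have hbb : ∀ j l, Integrable (fun k : ↥((standardMaximalCompactGL 3 L).comap (adelicVal (↥(maximalRealSubfield L)) L (IsCMField.complexConj L) 3 ((StdForm.antidiagonal 3).over L)) : Subgroup (quasiSplit (↥(maximalRealSubfield L)) L (IsCMField.complexConj L) 3).Adelic) => φ' j (k : (quasiSplit (↥(maximalRealSubfield L)) L (IsCMField.complexConj L) 3).Adelic) * conj (φ' l (k : (quasiSplit (↥(maximalRealSubfield L)) L (IsCMField.complexConj L) 3).Adelic))) μK := fun j l =>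
    integrable_restrict_mul_conj_of_bounded L μK (hφ'c j) (hφ'c l) (hφ'M j) (hφ'M l)
  obtain ⟨wc, Bc, d, h1, h2, h3, h4, h5, h6, h7, h8, h9, h10, h11, hform⟩ :=
    exists_hSCAT_of_coords L μK νI 𝓕I ν hν1 (ξ.bcη⁻¹ * ξ.bcψ⁻¹ * μω) φ φ' hqφ hqcP hqcq hD₁ hD₁P hD₂ hD₂P hint hbb hda hdq
  refine ⟨wc, Bc, d, h1, h2, h3, h4, h5, h6, h7, h8, h9, h10, ?_, h11⟩
  filter_upwards [hrealIn μK hμK νI hνI 𝓕I h𝓕I] with x hx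
  rw [hform]
  exact hx

end OfRecord

end Summit.HodgeConjecture.HodgeConjecture.Cruxes.H413.R90S8ResGMidBlockScatteringOfRecordU3

end
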